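import Mathlib
import HarnessLib
import Literature.Analysis.FluidPDE.ClassicalSolution
import Literature.Analysis.FluidPDE.VectorCalculus
import Summits.NavierStokesRegularity.NavierStokesRegularity.Theorems.UnthreadedRigidityDoorUnthreadedRigidityProfileHornDefs
import Summits.NavierStokesRegularity.NavierStokesRegularity.Theorems.UnthreadedRigidityDoorUnthreadedRigidityVirialHornDefs

/-!
# Route `UnthreadedRigidityDoor`, item `UnthreadedRigidity` (W2, stmt-NavierStokesRegularity-27585) — THREADING JETS, DEFINITIONS:
# the FORMAL JETS of the threading flux and the SLICE forms («L-parts») of the bridges PH / LEMMA SEP (LINE g10-2 «PROFILE HORN»)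
# and V (LINE g11-1 «VIRIAL HORN»)

Definition file (seat ns-crc-p1 g8; director-ns dss_142 «KEY BRIDGE V, M-PART», split of record crc-p1 = M / crc-p2 = L),
`--supports stmt-NavierStokesRegularity-27585 --as helper`.

THE OBJECTS.  For a velocity slice `v : ℝ³ → ℝ³` and a pressure slice `q : ℝ³ → ℝ` (explicit fields — NO Navier–Stokes solution):
* `nsTendency v q = Δv − (v·∇)v − ∇q` — the Navier–Stokes tendency (`= ∂ₜu` for a classical solution, by the momentum equation);
* `fluxJetOne v x₀ x = ⟪curl (Δv − (v·∇)v)(x), x − x₀⟫` — the FORMAL FIRST JET of the threading flux `⟪curl u, x − x₀⟫`;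
* `fluxJetTwo v q x₀ x = ⟪curl (Δv₁ − ((v·∇)v₁ + (v₁·∇)v))(x), x − x₀⟫`, `v₁ = nsTendency v q` — the FORMAL SECOND JET
  (the curl-free `∂ₜ∇p` dropped).
By the JET DICTIONARY (`…Theorems.UnthreadedRigidity.ThreadingJets`, file `…ThreadingJets.lean`: `derivWithin_threadingFlux_Ici`,
`iteratedDerivWithin_two_threadingFlux_Ici`) these ARE the one-sided first/second time-jets at `t₀` of the threading flux of a
classical solution on `[t₀, T)` with `v = u(t₀)`, `q = p(t₀)`.

THE STATEMENTS (pure SLICE statements about explicit fields; each is the «L-part» of a typed bridge, which follows from it by the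
dictionary — reductions in `…ThreadingJetsSlice.lean`):
* `OrderTwoSliceLaw` — L-part of bridge V `VirialHorn.OrderTwoVirialIdentity` (= (F2) ORDER-TWO LAW + (F3) VIRIAL LEMMA of the
  VIRIAL HORN card, §1–§2, for the decaying solution of the pressure Poisson equation);
* `HornSliceIdentityTwo` — L-part of bridge PH `ProfileHorn.HornIdentityTwo` (the `l = 2` profile-horn identity, GERMS.md §g10);
* `SeparableSliceOrderOneSilence` — L-part of LEMMA SEP `ProfileHorn.SeparableOrderOneSilence` (g9's LEMMA SEP at `l = 2`).
The hypotheses carried by each slice statement are exactly what the classical solution supplies at `t₀` for free (smoothness and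
incompressibility of `u₀`, smoothness of `p₀`, the pressure Poisson equation `Δp₀ = −div((u₀·∇)u₀)`, the decay `p₀ → 0` at `∞`),
so that the L-hand may use them without re-deriving them from `VirialAdmissible` / `HornAdmissible`.

WHAT THIS IS NOT: no NS-regularity statement is touched; `UnthreadedRigidity` (27585), W2 and NS regularity stay OPEN; these are the
objects of the M/L cut of two RUNG lines on the wall item; nobody here claims a bridge.  [cite: MajdaBertozziCUP2002, §1.1 (vector identities)]
-/

-- the summit and its single sub-problem share the name (CONVENTIONS §1)
set_option linter.dupNamespace false

namespace Summit.NavierStokesRegularity.NavierStokesRegularity.Theorems.UnthreadedRigidity.ThreadingJets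

open scoped Topology RealInnerProductSpace Laplacian
open Filter Set
open Literature.Analysis.FluidPDE
open Summit.NavierStokesRegularity.NavierStokesRegularity.Theorems.UnthreadedRigidity.ProfileHorn
  (E3 threadingFlux IsQuadForm HornAdmissible sepShell vortAmp discrCubic hornBracket)
open Summit.NavierStokesRegularity.NavierStokesRegularity.Theorems.UnthreadedRigidity.VirialHorn
  (IsSolidHarmonic VirialAdmissible sepShellL virialMoment angForm)

/-! ## The formal jets -/

/-- The NAVIER–STOKES TENDENCY of a slice `(v, q)`: `Δv − (v·∇)v − ∇q` (unit viscosity, no force) — the value of `∂ₜu` for a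
classical solution with `u(t) = v`, `p(t) = q` (momentum equation). -/
noncomputable def nsTendency (v : E3 → E3) (q : E3 → ℝ) : E3 → E3 :=
  fun z => (Δ v) z - convect v v z - gradient q z

/-- The FORMAL FIRST JET of the threading flux about `x₀`: `⟪curl (Δv − (v·∇)v)(x), x − x₀⟫` (the pressure gradient is curl free,
so it does not enter). -/
noncomputable def fluxJetOne (v : E3 → E3) (x₀ x : E3) : ℝ :=
  inner ℝ (curl (fun z => (Δ v) z - convect v v z) x) (x - x₀)

/-- The FORMAL SECOND JET of the threading flux about `x₀`: with `v₁ = nsTendency v q`,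
`⟪curl (Δv₁ − ((v·∇)v₁ + (v₁·∇)v))(x), x − x₀⟫` (the momentum equation differentiated once in time; the curl-free `∂ₜ∇p` dropped). -/
noncomputable def fluxJetTwo (v : E3 → E3) (q : E3 → ℝ) (x₀ x : E3) : ℝ :=
  inner ℝ (curl (fun z => (Δ (nsTendency v q)) z
    - (convect v (nsTendency v q) z + convect (nsTendency v q) v z)) x) (x - x₀)

/-! ## The slice forms («L-parts») of the bridges -/

/-- «ORDER-TWO SLICE LAW» — the L-part of bridge V `VirialHorn.OrderTwoVirialIdentity` (VIRIAL HORN card §1 (F2) + §2 (F3)): for a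
solid harmonic `Y` of degree `l ≥ 1`, a virial-admissible profile `H`, the separable shell `u₀ = curl curl (H(|y|) Y(y) y)` about
`x₀` (smooth and divergence free) and a smooth pressure slice `p₀` solving `Δp₀ = −div((u₀·∇)u₀)` and decaying at infinity:
if the formal second jet `fluxJetTwo u₀ p₀ x₀` vanishes identically, then `(∫₀^∞ r^{2l−3} α²) · {Y, |∇Y|²} ≡ 0`.
With the dictionary: `OrderTwoSliceLaw → OrderTwoVirialIdentity` (`orderTwoVirialIdentity_of_sliceLaw`). -/
def OrderTwoSliceLaw : Prop :=
  ∀ (l : ℕ) (x₀ : E3) (Y : E3 → ℝ) (H : ℝ → ℝ) (p₀ : E3 → ℝ),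
    1 ≤ l → IsSolidHarmonic l Y → VirialAdmissible l H →
    ContDiff ℝ (⊤ : ℕ∞) (sepShellL H Y x₀) →
    Literature.Analysis.FluidPDE.VectorCalculus.IsDivFree (sepShellL H Y x₀) →
    ContDiff ℝ (⊤ : ℕ∞) p₀ →
    (∀ x : E3, (Δ p₀) x =
      -Literature.Analysis.FluidPDE.VectorCalculus.divergence (convect (sepShellL H Y x₀) (sepShellL H Y x₀)) x) →
    Tendsto p₀ (cocompact E3) (𝓝 0) →
    (∀ x : E3, fluxJetTwo (sepShellL H Y x₀) p₀ x₀ x = 0) →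
    ∀ ξ : E3, virialMoment l H * angForm Y ξ = 0

/-- «HORN SLICE IDENTITY at l = 2» — the L-part of bridge PH `ProfileHorn.HornIdentityTwo` (GERMS.md §g10, engine-exact kit j321644):
for a quadratic form `Q`, a horn-admissible profile `H`, the separable `l = 2` shell `u₀ = sepShell H Q x₀` (smooth, divergence free)
and a smooth decaying solution `p₀` of `Δp₀ = −div((u₀·∇)u₀)`, the formal second jet on the sphere of radius `r > 0` about `x₀` is
`K(r) · r³ · D_Q(y) · W̃[H](r)`.  With the dictionary: `HornSliceIdentityTwo → HornIdentityTwo` (`hornIdentityTwo_of_slice`). -/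
def HornSliceIdentityTwo : Prop :=
  ∀ (Q : Matrix (Fin 3) (Fin 3) ℝ) (H : ℝ → ℝ) (x₀ : E3) (p₀ : E3 → ℝ),
    IsQuadForm Q → HornAdmissible H →
    ContDiff ℝ (⊤ : ℕ∞) (sepShell H Q x₀) →
    Literature.Analysis.FluidPDE.VectorCalculus.IsDivFree (sepShell H Q x₀) →
    ContDiff ℝ (⊤ : ℕ∞) p₀ →
    (∀ x : E3, (Δ p₀) x =
      -Literature.Analysis.FluidPDE.VectorCalculus.divergence (convect (sepShell H Q x₀) (sepShell H Q x₀)) x) →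
    Tendsto p₀ (cocompact E3) (𝓝 0) →
    ∀ r : ℝ, 0 < r → ∀ y : E3, ‖y‖ = 1 →
      fluxJetTwo (sepShell H Q x₀) p₀ x₀ (x₀ + r • y) = vortAmp H r * r ^ 3 * discrCubic Q y * hornBracket H r

/-- «SEPARABLE SLICE ORDER-ONE SILENCE at l = 2» — the L-part of LEMMA SEP `ProfileHorn.SeparableOrderOneSilence` (g9's LEMMA SEP:
`c₁ = −6(HK − KH){Y,Y} = 0`): the formal first jet of a smooth divergence-free separable `l = 2` shell vanishes identically.
With the dictionary: `SeparableSliceOrderOneSilence → SeparableOrderOneSilence` (`separableOrderOneSilence_of_slice`). -/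
def SeparableSliceOrderOneSilence : Prop :=
  ∀ (Q : Matrix (Fin 3) (Fin 3) ℝ) (H : ℝ → ℝ) (x₀ : E3),
    IsQuadForm Q → HornAdmissible H →
    ContDiff ℝ (⊤ : ℕ∞) (sepShell H Q x₀) →
    Literature.Analysis.FluidPDE.VectorCalculus.IsDivFree (sepShell H Q x₀) →
    ∀ x : E3, fluxJetOne (sepShell H Q x₀) x₀ x = 0

end Summit.NavierStokesRegularity.NavierStokesRegularity.Theorems.UnthreadedRigidity.ThreadingJets
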